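import Literature.NumberTheory.GaloisRepresentations.ShapiroIsomorphism
import Literature.NumberTheory.GaloisRepresentations.ContinuousShapiroLift
import Literature.NumberTheory.GaloisRepresentations.ContinuousCohomologyAdditiveTransport
import Mathlib.Topology.Algebra.OpenSubgroup
import HarnessLib

/-!
# Shapiro's lemma for an OPEN subgroup in the finite permutation model `Maps(G ⧸ U, M)`, and the
# cardinality bookkeeping of Euler characteristics (Serre I §2.5 Prop. 10; NSW (1.6.4))

Topic `NumberTheory/GaloisRepresentations` (continuous cochain cohomology); namespace
`Literature.NumberTheory.GaloisRepresentations` (dot notation under `ContinuousRep`).  Definitions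
with bodies and theorems; no named fact, no `sorry`, no instance, no notation.

Let `G` be a compact topological group (profinite in §3), `U ≤ G` an OPEN subgroup (hence closed and
of finite index) and `ρ : G → Aut(M)` a continuous representation on a DISCRETE abelian group `M`
(`ContinuousRep G ℤ M`).  The tree holds two models of the coinduced module:

* Serre's `M_G^U(A) = {a* : G → A continuous | a*(u x) = u a*(x)}`, `(g a*)(x) = a*(x g)`
  (`CoinducedModule.coindModule` / `coindRep`, for a CLOSED subgroup and a `U`-module `A`), for which
  the tree PROVES Shapiro's lemma in every degree, `shapiroAddEquiv σ n : Hⁿ(G, M_G^U(A)) ≃+ Hⁿ(U, A)`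
  (`ShapiroIsomorphism.lean`; Serre, *Cohomologie galoisienne* I §2.5 Prop. 10);
* the finite permutation model `Maps(G ⧸ U, M)` with the diagonal action `(g ⋆ φ)(y) = g • φ(g⁻¹ y)`
  (`ContinuousShapiroLift.coindFin ρ.toTopRep U`; "`Ind_U^G Res_U M ≅ M ⊗ ℤ[G/U]` with the
  diagonal action", Neukirch–Schmidt–Wingberg I §6), a topological representation `TopRep ℤ G`.

This file identifies the two for `A = Res_U M` and reads Shapiro's lemma in the second model:

* §1 `ρ.coindOpen U hU : ContinuousRep G ℤ (G ⧸ U → M)` — `Maps(G ⧸ U, M)` as a continuous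
  representation on a discrete module (`toTopRep` is `coindFin ρ.toTopRep U` definitionally), the
  unit `coindOpenUnit : M ⟶ Maps(G ⧸ U, M)` (constant functions, injective), its cardinality
  `#M ^ [G : U]`, discreteness, finiteness, `p`-primary torsion, exponent;
* §2 the equivariant continuous additive identification
  **`ρ.coindOpenEquiv U hU : Maps(G ⧸ U, M) ≃ₜ+ M_G^U(Res_U M)`**, `φ ↦ (x ↦ x • φ(x⁻¹ U))`, inverse
  `a* ↦ (g U ↦ g • a*(g⁻¹))` (Serre I §2.5: "lorsque … `A` est un `G`-module, `M_G^H(A)` s'identifie à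
  … `A ⊗ ℤ[G/H]`"; NSW I §6 p. 62);
* §3 (for `G` profinite) **`ρ.shapiroOpenAddEquiv U hU n : Hⁿ(G, Maps(G ⧸ U, M)) ≃+ Hⁿ(U, Res_U M)`**
  and its `Nat.card` / `Finite` / `Subsingleton` readings;
* §4 the EULER-CHARACTERISTIC TRANSFER: for every `e : ℕ`,
  `#H⁰(U, M)·#H²(U, M)·#M^(e·[G:U]) = #H¹(U, M)  ↔  #H⁰(G, C)·#H²(G, C)·#C^e = #H¹(G, C)`,
  `C = Maps(G ⧸ U, M)` — the bookkeeping by which Tate's global Euler–Poincaré characteristic formula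
  over a totally complex number field `K` (Milne, *ADT* I Thm. 5.1, exponent `e = r₂(K)`,
  `r₂(K′) = [K′ : K]·r₂(K)`) passes between `G_{K′,S} ≤ G_{K,S}` and `G_{K,S}` (Milne I §5, proof of
  Thm. 5.1: "an argument as in the proof of Theorem 2.8 … allows us to replace `K` by a larger field";
  lane «TATE-EPC-TC» of cell `bsd-eis`, brick B2, `--supports stmt-BirchSwinnertonDyer-19032`).

HONEST FRAMING: homological algebra of profinite groups only; no arithmetic statement, no case of
Tate's theorem and no case of BSD is proved here.

## References
* J.-P. Serre, *Cohomologie galoisienne*, 5e éd., LNM 5 (1994) / *Galois Cohomology* (1997),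
  I §2.5 (modules induits; Prop. 10). [SerreGaloisCohomology1997]
* J. Neukirch, A. Schmidt, K. Wingberg, *Cohomology of Number Fields*, 2nd ed. (2008), I §6
  (induced modules, Prop. (1.6.4) Shapiro's lemma). [NeukirchSchmidtWingberg2008]
* J. S. Milne, *Arithmetic Duality Theorems*, 2nd ed. (2006), I §2 (proof of Thm. 2.8), I §5
  (proof of Thm. 5.1). [MilneADT2006]

## Design notes
* `G`, `M` in one universe (as `ShapiroIsomorphism`, `ContinuousShapiroLift`, `GroupCdLE`).
* `[CompactSpace G]` throughout: it makes `G ⧸ U` finite (`Subgroup.quotient_finite_of_isOpen`), hence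
  `Maps(G ⧸ U, M)` discrete, and is anyway a hypothesis of the tree's Shapiro isomorphism; §3 adds
  `[T2Space G] [TotallyDisconnectedSpace G]` (profinite), as `shapiroAddEquiv` does.
* Cohomology is Mathlib's `continuousCohomology n X.toTopRep` (carrier), the currency of
  `ShapiroIsomorphism`, `GroupCdLE` and `RestrictedRamificationFiniteCoefficients`; the tree's
  `ContinuousRep.H` is the same type by `rfl`.
-/

noncomputable section

open CategoryTheory Function
open scoped Topology

universe u

namespace Literature.NumberTheory.GaloisRepresentations

namespace ContinuousRep

variable {G : Type u} [Group G] [TopologicalSpace G] [IsTopologicalGroup G] [CompactSpace G]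
variable {M : Type u} [AddCommGroup M] [TopologicalSpace M] [DiscreteTopology M]
  (ρ : ContinuousRep G ℤ M) (U : Subgroup G) (hU : IsOpen (U : Set G))

/-! ## §1 `Maps(G ⧸ U, M)` as a continuous representation on a discrete module -/

/-- **`Maps(G ⧸ U, M)` with the diagonal action `(g ⋆ φ)(y) = g • φ(g⁻¹ • y)`** as a continuous
representation of the compact group `G` on a discrete module, for `U` an open subgroup (so that
`G ⧸ U` is finite and `G ⧸ U → M` discrete): the action of the tree's `coindFin ρ.toTopRep U`
(`toTopRep_coindOpen`).  Continuity: the stabiliser of `φ` contains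
`⋂_y ({g | g • y = y} ∩ Stab_ρ(φ y))`, a neighbourhood of `1`.
[cite: NeukirchSchmidtWingberg2008, I §6 (induced modules)] [cite: SerreGaloisCohomology1997, I §2.5] -/
def coindOpen : ContinuousRep G ℤ (G ⧸ U → M) :=
  haveI : Finite (G ⧸ U) := Subgroup.quotient_finite_of_isOpen U hU
  ContinuousRep.ofStabilizerMemNhdsOne (coindFinRep ρ.toTopRep U).toRepresentation fun φ => by
    have hcos : ∀ y : G ⧸ U, ∀ᶠ g in 𝓝 (1 : G), g⁻¹ • y = y := fun y => by
      induction y using QuotientGroup.induction_on with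
      | H x =>
        have hc : Continuous fun g : G => x⁻¹ * g * x :=
          (continuous_const.mul continuous_id).mul continuous_const
        have hmem : (fun g : G => x⁻¹ * g * x) ⁻¹' (U : Set G) ∈ 𝓝 (1 : G) :=
          hc.continuousAt.preimage_mem_nhds
            (by simpa only [mul_one, inv_mul_cancel] using hU.mem_nhds U.one_mem)
        filter_upwards [hmem] with g hg
        rw [MulAction.Quotient.smul_coe, QuotientGroup.eq, smul_eq_mul, mul_inv_rev, inv_inv]
        exact hg
    have hval : ∀ y : G ⧸ U, ∀ᶠ g in 𝓝 (1 : G), ρ g (φ y) = φ y := fun y =>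
      ρ.setOf_apply_eq_mem_nhds_one (φ y)
    filter_upwards [Filter.eventually_all.2 hcos, Filter.eventually_all.2 hval] with g hg hg'
    funext y
    change (ρ.toTopRep).ρ g (φ (g⁻¹ • y)) = φ y
    rw [hg y]
    exact hg' y

/-- The action of `Maps(G ⧸ U, M)`: `(g ⋆ φ)(y) = g • φ(g⁻¹ • y)`.
[cite: NeukirchSchmidtWingberg2008, I §6 (induced modules)] -/
@[simp] theorem coindOpen_apply_apply (g : G) (φ : G ⧸ U → M) (y : G ⧸ U) :
    ρ.coindOpen U hU g φ y = ρ g (φ (g⁻¹ • y)) := rfl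

/-- **`Maps(G ⧸ U, M)` IS the tree's `coindFin ρ.toTopRep U`** as a topological representation
(definitionally), so that its continuous cohomology is `continuousCohomology n (coindFin ρ.toTopRep U)`
and the degree-one Shapiro lift of `ContinuousShapiroLift` lands in it.
[cite: NeukirchSchmidtWingberg2008, I §6 Prop. (1.6.4)] -/
theorem toTopRep_coindOpen : (ρ.coindOpen U hU).toTopRep = coindFin.{0, u} ρ.toTopRep U := rfl

omit [AddCommGroup M] in
include hU in
/-- `Maps(G ⧸ U, M)` is discrete (`G ⧸ U` finite, `M` discrete) — the instance hypothesis of the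
tree's long exact sequence `DiscreteRepContinuousCohomologyLES` for these coefficients.
[cite: NeukirchSchmidtWingberg2008, I §6 (induced modules)] -/
theorem discreteTopology_coindOpen : DiscreteTopology (G ⧸ U → M) := by
  haveI : Finite (G ⧸ U) := Subgroup.quotient_finite_of_isOpen U hU
  infer_instance

/-- **The unit `M ⟶ Maps(G ⧸ U, M)`, `m ↦ (y ↦ m)`** (constant functions; `G`-equivariant:
`(g ⋆ const m) = const (g • m)`), a morphism of topological representations — the first map of the
presentation `0 → M → Ind_U^G Res_U M → M″ → 0` (Milne, *ADT* I, proof of Thm. 1.8 / Lemma 4.14).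
[cite: MilneADT2006, I §1 (proof of Thm. 1.8)] [cite: NeukirchSchmidtWingberg2008, I §6 (induced modules)] -/
def coindOpenUnit : ρ.toTopRep ⟶ (ρ.coindOpen U hU).toTopRep :=
  TopRep.ofHom
    { toLinearMap :=
        { toFun := fun m _ => m
          map_add' := fun _ _ => rfl
          map_smul' := fun _ _ => rfl }
      cont := continuous_pi fun _ => continuous_id
      isIntertwining' := fun g => by
        ext m y
        rfl }

/-- Formula: `coindOpenUnit m y = m`. [cite: NeukirchSchmidtWingberg2008, I §6 (induced modules)] -/
@[simp] theorem coindOpenUnit_apply (m : M) (y : G ⧸ U) : (ρ.coindOpenUnit U hU).hom m y = m := rfl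

/-- The unit `M ⟶ Maps(G ⧸ U, M)` is injective. [cite: MilneADT2006, I §1 (proof of Thm. 1.8)] -/
theorem coindOpenUnit_injective : Function.Injective (ρ.coindOpenUnit U hU).hom :=
  fun _ _ h => congr_fun h ((1 : G) : G ⧸ U)

omit [AddCommGroup M] [TopologicalSpace M] [DiscreteTopology M] in
include hU in
/-- **`#Maps(G ⧸ U, M) = #M ^ [G : U]`.** [cite: NeukirchSchmidtWingberg2008, I §6 (induced modules)] -/
theorem natCard_coindOpen : Nat.card (G ⧸ U → M) = Nat.card M ^ U.index := by
  haveI : Finite (G ⧸ U) := Subgroup.quotient_finite_of_isOpen U hU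
  rw [Nat.card_fun, Subgroup.index_eq_card]

omit [AddCommGroup M] [TopologicalSpace M] [DiscreteTopology M] in
include hU in
/-- `Maps(G ⧸ U, M)` is finite when `M` is. [cite: NeukirchSchmidtWingberg2008, I §6 (induced modules)] -/
theorem finite_coindOpen [Finite M] : Finite (G ⧸ U → M) := by
  haveI : Finite (G ⧸ U) := Subgroup.quotient_finite_of_isOpen U hU
  infer_instance

omit [TopologicalSpace M] [DiscreteTopology M] in
include hU in
/-- `Maps(G ⧸ U, M)` is `p`-primary torsion when `M` is (finitely many values).
[cite: SerreGaloisCohomology1997, I §3.3 (proof of Prop. 14)] -/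
theorem isPrimaryTorsion_coindOpen {p : ℕ} (hM : IsPrimaryTorsion p M) :
    IsPrimaryTorsion p (G ⧸ U → M) := by
  haveI : Finite (G ⧸ U) := Subgroup.quotient_finite_of_isOpen U hU
  haveI : Fintype (G ⧸ U) := Fintype.ofFinite _
  intro φ
  choose r hr using hM
  refine ⟨Finset.univ.sup fun y => r (φ y), funext fun y => ?_⟩
  obtain ⟨k, hk⟩ := Nat.exists_eq_add_of_le
    (Finset.le_sup (f := fun y => r (φ y)) (Finset.mem_univ y))
  rw [Pi.smul_apply, Pi.zero_apply, hk, pow_add, mul_comm, mul_smul, hr, smul_zero]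

omit [TopologicalSpace G] [IsTopologicalGroup G] [CompactSpace G] [TopologicalSpace M]
  [DiscreteTopology M] in
/-- If `n` kills `M` it kills `Maps(G ⧸ U, M)`. [cite: NeukirchSchmidtWingberg2008, I §6 (induced modules)] -/
theorem natCast_smul_coindOpen_eq_zero {n : ℕ} (hM : ∀ m : M, (n : ℤ) • m = 0) (φ : G ⧸ U → M) :
    (n : ℤ) • φ = 0 :=
  funext fun y => by rw [Pi.smul_apply, Pi.zero_apply, hM]

/-! ## §2 `Maps(G ⧸ U, M) ≃ M_G^U(Res_U M)`, equivariantly -/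

omit [CompactSpace G] [DiscreteTopology M] in
include hU in
/-- The function `x ↦ x • φ(x⁻¹ U)` attached to `φ : G ⧸ U → M`: continuous (`U` open, `M`
discrete). [cite: SerreGaloisCohomology1997, I §2.5] -/
theorem continuous_apply_inv_mk (φ : G ⧸ U → M) :
    Continuous fun x : G => ρ x (φ ((x⁻¹ : G) : G ⧸ U)) := by
  haveI : DiscreteTopology (G ⧸ U) := QuotientGroup.discreteTopology hU
  have hφ : Continuous fun x : G => φ ((x⁻¹ : G) : G ⧸ U) :=
    continuous_of_discreteTopology.comp (QuotientGroup.continuous_mk.comp continuous_inv)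
  exact ρ.continuous_smul.comp (continuous_id.prodMk hφ)

/-- **`φ ↦ (x ↦ x • φ(x⁻¹ U))`, `Maps(G ⧸ U, M) → M_G^U(Res_U M)`** (the function satisfies
`a*(u x) = u • a*(x)` because `(u x)⁻¹ U = x⁻¹ U`). [cite: SerreGaloisCohomology1997, I §2.5] -/
def toCoindModule (φ : G ⧸ U → M) : coindModule (ρ.restrict (subgroupIncl U)) :=
  ⟨⟨fun x => ρ x (φ ((x⁻¹ : G) : G ⧸ U)), ρ.continuous_apply_inv_mk U hU φ⟩, fun s x => by
    change ρ ((s : G) * x) (φ ((((s : G) * x)⁻¹ : G) : G ⧸ U)) = ρ (subgroupIncl U s) (ρ x _)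
    have hq : ((((s : G) * x)⁻¹ : G) : G ⧸ U) = ((x⁻¹ : G) : G ⧸ U) := by
      rw [QuotientGroup.eq, inv_inv, mul_inv_cancel_right]
      exact s.2
    rw [hq, map_mul, Module.End.mul_apply, subgroupIncl_apply]⟩

omit [CompactSpace G] in
/-- Formula: `(toCoindModule φ)(x) = x • φ(x⁻¹ U)`. [cite: SerreGaloisCohomology1997, I §2.5] -/
@[simp] theorem toCoindModule_apply (φ : G ⧸ U → M) (x : G) :
    ((ρ.toCoindModule U hU φ : coindModule (ρ.restrict (subgroupIncl U))) : C(G, M)) x =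
      ρ x (φ ((x⁻¹ : G) : G ⧸ U)) := rfl

/-- **`a* ↦ (g U ↦ g • a*(g⁻¹))`, `M_G^U(Res_U M) → Maps(G ⧸ U, M)`** (well defined: for `u ∈ U`,
`(g u) • a*(u⁻¹ g⁻¹) = g • a*(g⁻¹)`). [cite: SerreGaloisCohomology1997, I §2.5] -/
def ofCoindModule (a : coindModule (ρ.restrict (subgroupIncl U))) : G ⧸ U → M := fun y =>
  Quotient.liftOn' y (fun g : G => ρ g ((a : C(G, M)) g⁻¹)) fun g h hgh => by
    have ha : ∀ (s : U) (x : G), (a : C(G, M)) ((s : G) * x) = ρ s ((a : C(G, M)) x) :=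
      fun s x => (mem_coind_iff _ _).1 a.2 s x
    rw [QuotientGroup.leftRel_apply] at hgh
    -- `h = g u`, `u = g⁻¹ h ∈ U`
    have key : ρ h ((a : C(G, M)) h⁻¹) = ρ g ((a : C(G, M)) g⁻¹) := by
      have h1 : h⁻¹ = ((⟨g⁻¹ * h, hgh⟩⁻¹ : U) : G) * g⁻¹ := by
        rw [Subgroup.coe_inv, mul_inv_rev, inv_inv, mul_inv_cancel_right]
      have h2 : h * (((⟨g⁻¹ * h, hgh⟩⁻¹ : U) : G)) = g := by
        rw [Subgroup.coe_inv, mul_inv_rev, inv_inv, mul_inv_cancel_left]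
      rw [h1, ha, ← Module.End.mul_apply, ← map_mul, h2]
    exact key.symm

omit [IsTopologicalGroup G] [CompactSpace G] in
/-- Formula on a coset: `ofCoindModule a (g U) = g • a(g⁻¹)`. [cite: SerreGaloisCohomology1997, I §2.5] -/
@[simp] theorem ofCoindModule_mk (a : coindModule (ρ.restrict (subgroupIncl U))) (g : G) :
    ρ.ofCoindModule U a (g : G ⧸ U) = ρ g ((a : C(G, M)) g⁻¹) := rfl

omit [CompactSpace G] in
/-- `ofCoindModule ∘ toCoindModule = id`. [cite: SerreGaloisCohomology1997, I §2.5] -/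
theorem ofCoindModule_toCoindModule (φ : G ⧸ U → M) :
    ρ.ofCoindModule U (ρ.toCoindModule U hU φ) = φ := by
  funext y
  induction y using QuotientGroup.induction_on with
  | H g => rw [ofCoindModule_mk, toCoindModule_apply, inv_inv, ← Module.End.mul_apply, ← map_mul,
      mul_inv_cancel, map_one, Module.End.one_apply]

omit [CompactSpace G] in
/-- `toCoindModule ∘ ofCoindModule = id`. [cite: SerreGaloisCohomology1997, I §2.5] -/
theorem toCoindModule_ofCoindModule (a : coindModule (ρ.restrict (subgroupIncl U))) :
    ρ.toCoindModule U hU (ρ.ofCoindModule U a) = a := by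
  apply Subtype.ext
  ext x
  rw [toCoindModule_apply, ofCoindModule_mk, inv_inv, ← Module.End.mul_apply, ← map_mul,
    mul_inv_cancel, map_one, Module.End.one_apply]

/-- **`Maps(G ⧸ U, M) ≃ₜ+ M_G^U(Res_U M)`**, `φ ↦ (x ↦ x • φ(x⁻¹ U))` — a continuous additive
equivalence (both sides are discrete: `G ⧸ U` is finite, and `M_G^U(A) ⊆ C(G, A)` is discrete for
`G` compact, `discreteTopology_coind`).  Serre I §2.5: for a `G`-module `A`, `M_G^H(A)` "s'identifie"
to the induced module `A ⊗ ℤ[G/H]`. [cite: SerreGaloisCohomology1997, I §2.5]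
[cite: NeukirchSchmidtWingberg2008, I §6 (induced modules)] -/
def coindOpenEquiv : (G ⧸ U → M) ≃ₜ+ coindModule (ρ.restrict (subgroupIncl U)) :=
  haveI : Finite (G ⧸ U) := Subgroup.quotient_finite_of_isOpen U hU
  haveI : DiscreteTopology (coindModule (ρ.restrict (subgroupIncl U))) := discreteTopology_coind _
  { toFun := ρ.toCoindModule U hU
    invFun := ρ.ofCoindModule U
    left_inv := ρ.ofCoindModule_toCoindModule U hU
    right_inv := ρ.toCoindModule_ofCoindModule U hU
    map_add' := fun φ ψ => by
      apply Subtype.ext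
      ext x
      simp only [toCoindModule_apply, Pi.add_apply, map_add, Submodule.coe_add,
        ContinuousMap.add_apply]
    continuous_toFun := continuous_of_discreteTopology
    continuous_invFun := continuous_of_discreteTopology }

/-- Formula for `coindOpenEquiv`. [cite: SerreGaloisCohomology1997, I §2.5] -/
@[simp] theorem coindOpenEquiv_apply (φ : G ⧸ U → M) :
    ρ.coindOpenEquiv U hU φ = ρ.toCoindModule U hU φ := rfl

/-- Formula for the inverse of `coindOpenEquiv`. [cite: SerreGaloisCohomology1997, I §2.5] -/
@[simp] theorem coindOpenEquiv_symm_apply (a : coindModule (ρ.restrict (subgroupIncl U))) :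
    (ρ.coindOpenEquiv U hU).symm a = ρ.ofCoindModule U a := rfl

/-- **Equivariance**: `coindOpenEquiv (g ⋆ φ) = g · coindOpenEquiv φ` for Serre's action
`(g a*)(x) = a*(x g)` (both sides are `x ↦ (x g) • φ((x g)⁻¹ U)`).
[cite: SerreGaloisCohomology1997, I §2.5] -/
theorem coindOpenEquiv_map (g : G) (φ : G ⧸ U → M) :
    ρ.coindOpenEquiv U hU (ρ.coindOpen U hU g φ) =
      coindRep (ρ.restrict (subgroupIncl U)) g (ρ.coindOpenEquiv U hU φ) := by
  apply Subtype.ext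
  ext x
  rw [coindOpenEquiv_apply, coindOpenEquiv_apply, coindRep_apply_apply, toCoindModule_apply,
    toCoindModule_apply, coindOpen_apply_apply, ← Module.End.mul_apply, ← map_mul,
    MulAction.Quotient.smul_coe, smul_eq_mul, mul_inv_rev]

/-! ## §3 Shapiro's lemma in the permutation model: `Hⁿ(G, Maps(G ⧸ U, M)) ≃+ Hⁿ(U, M)` -/

section Shapiro

variable [T2Space G] [TotallyDisconnectedSpace G]

/-- **Shapiro's lemma for an open subgroup, permutation model:
`Hⁿ(G, Maps(G ⧸ U, M)) ≃+ Hⁿ(U, Res_U M)`** in every degree `n`, for `G` profinite, `U` open and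
`M` a discrete `G`-module — transport along `coindOpenEquiv` (continuous cohomology of
equivariantly homeomorphic coefficients, `continuousCohomologyAddEquiv`) followed by the tree's
Shapiro isomorphism `shapiroAddEquiv` for Serre's model `M_G^U(Res_U M)`.
[cite: SerreGaloisCohomology1997, I §2.5 Prop. 10] [cite: NeukirchSchmidtWingberg2008, I §6 Prop. (1.6.4)] -/
def shapiroOpenAddEquiv (n : ℕ) :
    (continuousCohomology n (ρ.coindOpen U hU).toTopRep : Type u) ≃+
      (continuousCohomology n (ρ.restrict (subgroupIncl U)).toTopRep : Type u) :=
  haveI : IsClosed (U : Set G) := Subgroup.isClosed_of_isOpen U hU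
  (continuousCohomologyAddEquiv (X := (ρ.coindOpen U hU).toTopRep)
      (Y := (coindRep (ρ.restrict (subgroupIncl U))).toTopRep)
      (ρ.coindOpenEquiv U hU : (G ⧸ U → M) ≃ₜ+ _) (fun g φ => ρ.coindOpenEquiv_map U hU g φ) n).trans
    (shapiroAddEquiv (ρ.restrict (subgroupIncl U)) n)

/-- `Nonempty` form of `shapiroOpenAddEquiv`. [cite: SerreGaloisCohomology1997, I §2.5 Prop. 10] -/
theorem nonempty_continuousCohomology_coindOpen_addEquiv (n : ℕ) :
    Nonempty ((continuousCohomology n (ρ.coindOpen U hU).toTopRep : Type u) ≃+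
      (continuousCohomology n (ρ.restrict (subgroupIncl U)).toTopRep : Type u)) :=
  ⟨ρ.shapiroOpenAddEquiv U hU n⟩

include hU in
/-- The same for the tree's `coindFin ρ.toTopRep U` (definitionally equal coefficients).
[cite: NeukirchSchmidtWingberg2008, I §6 Prop. (1.6.4)] -/
theorem nonempty_continuousCohomology_coindFin_addEquiv (n : ℕ) :
    Nonempty ((continuousCohomology n (coindFin.{0, u} ρ.toTopRep U) : Type u) ≃+
      (continuousCohomology n (ρ.restrict (subgroupIncl U)).toTopRep : Type u)) :=
  ⟨ρ.shapiroOpenAddEquiv U hU n⟩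

/-- **`#Hⁿ(G, Maps(G ⧸ U, M)) = #Hⁿ(U, M)`.** [cite: SerreGaloisCohomology1997, I §2.5 Prop. 10] -/
theorem natCard_continuousCohomology_coindOpen (n : ℕ) :
    Nat.card (continuousCohomology n (ρ.coindOpen U hU).toTopRep) =
      Nat.card (continuousCohomology n (ρ.restrict (subgroupIncl U)).toTopRep) :=
  Nat.card_congr (ρ.shapiroOpenAddEquiv U hU n).toEquiv

/-- `Hⁿ(G, Maps(G ⧸ U, M))` is finite iff `Hⁿ(U, M)` is. [cite: SerreGaloisCohomology1997, I §2.5 Prop. 10] -/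
theorem finite_continuousCohomology_coindOpen_iff (n : ℕ) :
    Finite (continuousCohomology n (ρ.coindOpen U hU).toTopRep) ↔
      Finite (continuousCohomology n (ρ.restrict (subgroupIncl U)).toTopRep) :=
  Equiv.finite_iff (ρ.shapiroOpenAddEquiv U hU n).toEquiv

/-- `Hⁿ(G, Maps(G ⧸ U, M)) = 0` iff `Hⁿ(U, M) = 0`. [cite: SerreGaloisCohomology1997, I §2.5 Prop. 10] -/
theorem subsingleton_continuousCohomology_coindOpen_iff (n : ℕ) :
    Subsingleton (continuousCohomology n (ρ.coindOpen U hU).toTopRep) ↔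
      Subsingleton (continuousCohomology n (ρ.restrict (subgroupIncl U)).toTopRep) :=
  ⟨fun _ => (ρ.shapiroOpenAddEquiv U hU n).symm.toEquiv.subsingleton,
    fun _ => (ρ.shapiroOpenAddEquiv U hU n).toEquiv.subsingleton⟩

/-! ## §4 The Euler-characteristic transfer -/

/-- **Euler-characteristic transfer along Shapiro's lemma.**  For `C = Maps(G ⧸ U, M)` and any
`e : ℕ`: `#H⁰(U, M)·#H²(U, M)·#M^(e·[G:U]) = #H¹(U, M)` iff `#H⁰(G, C)·#H²(G, C)·#C^e = #H¹(G, C)`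
(Shapiro in degrees `0, 1, 2` and `#C = #M^[G:U]`).  With `G = G_{K,S}`, `U = G_{K′,S}` and
`e = r₂(K)` (so `e·[G:U] = r₂(K′)` for `K` totally complex) this is the passage "replace `K` by a larger
field" in the proof of Tate's global Euler–Poincaré characteristic formula.
[cite: MilneADT2006, I §5 (proof of Thm. 5.1) and I §2 (proof of Thm. 2.8)]
[cite: SerreGaloisCohomology1997, I §2.5 Prop. 10] -/
theorem euler_coindOpen_iff (e : ℕ) :
    Nat.card (continuousCohomology 0 (ρ.restrict (subgroupIncl U)).toTopRep) *
          Nat.card (continuousCohomology 2 (ρ.restrict (subgroupIncl U)).toTopRep) *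
          Nat.card M ^ (e * U.index) =
        Nat.card (continuousCohomology 1 (ρ.restrict (subgroupIncl U)).toTopRep) ↔
      Nat.card (continuousCohomology 0 (ρ.coindOpen U hU).toTopRep) *
          Nat.card (continuousCohomology 2 (ρ.coindOpen U hU).toTopRep) *
          Nat.card (G ⧸ U → M) ^ e =
        Nat.card (continuousCohomology 1 (ρ.coindOpen U hU).toTopRep) := by
  rw [ρ.natCard_continuousCohomology_coindOpen U hU 0, ρ.natCard_continuousCohomology_coindOpen U hU 1,
    ρ.natCard_continuousCohomology_coindOpen U hU 2, natCard_coindOpen (M := M) U hU, ← pow_mul,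
    mul_comm U.index e]

end Shapiro

end ContinuousRep

end Literature.NumberTheory.GaloisRepresentations

end
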